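import Summits.ValiantsHypothesis.ValiantsHypothesis.Theorems.MonotoneRestorationOrbitRestorationQPValueSupport
import Summits.ValiantsHypothesis.ValiantsHypothesis.Theorems.MonotoneRestorationOrbitRestorationQPValueOrbitClosure
import Summits.ValiantsHypothesis.ValiantsHypothesis.Theorems.MonotoneRestorationOrbitRestorationQPValueOrbitWide
import HarnessLib

/-!
# The support theorem for values: small orbits everywhere force RIGID supports everywhere (ORBIT currency, XVIII)

Route MonotoneRestoration, crux `OrbitRestorationQP` (stmt-ValiantsHypothesis-18293), namespace
`Summit.ValiantsHypothesis.ValiantsHypothesis.Theorems.ValueSymSupport`.  Route-independent (no `Theses` import).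

By `ValueOrbit.orbitRestorationQP_iff_valueOrbitQP` the crux is a statement about the `Sym(Fin n)`-orbits of the
intermediate VALUES of ordinary computations.  `ValueSupport.exists_altSupport_of_ncard_lt_choose` turns a small
orbit of ONE value into an ALTERNATING support (the even permutations fixing `< k` indices fix the value;
Dixon–Mortimer 5.2B) and upgrades it to a genuine support only for AFFINE values.  A single small-orbit value need
not be supported: the diagonal Vandermonde `det (x_ii ^ j)_{i,j} = Π_{i<j} (x_jj − x_ii)` has orbit `2`
(`ncard_orbit_diagVandermonde_le_two`) and alternating support `∅`, but every transposition negates it.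

THIS FILE: inside a COMPUTATION the upgrade holds for EVERY value.  If all values of a value derivation have
fewer than `C(n,k)` translates (`n > 8`, `3 ≤ k`, `4k ≤ n`), then every value is fixed by the FULL pointwise
stabiliser of fewer than `k` indices (`exists_symSupport`) — a support in the sense of Dawar–Wilsenach Def. 6.1;
so the support theorem of rigid symmetric circuits (Anderson–Dawar, Dawar–Wilsenach Thm 6.3) holds verbatim for
the values of small-orbit computations, with the converse `ValueOrbit.orbit_bounded_of_supported` already landed.
Induction on the rank of the derivation: variables, constants and binary products are fixed by the pointwise
stabiliser of a small set outright, and then the alternating support is upgraded by one far-away transposition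
(`symFixes_of_altFixes_of_fixes`); for a weighted SUM `q = Σ c_u u` of supported values, the sum of `ren g q`
over the even permutations `g` fixing the alternating support `X` of `q` pointwise is `N • q`, the sum of
`ren (g τ) q` for a transposition `τ` outside `X` is `N • (ren τ q)`, and the two sums agree summand by summand
after re-indexing `g ↦ g τ τ_u` with a transposition `τ_u` fixing `u` (`symFixes_sum`) — no inner product, no
character theory.

Consequences: the same for wide derivations of small orbit WIDTH (`exists_symSupport_of_wide`) and for the
values behind `QPOrbitRestorable` (`exists_symSupport_of_qpOrbitRestorable`); TWISTED VALUES NEVER OCCUR: the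
diagonal Vandermonde is not a value of any such computation (`diagVandermonde_not_mem`) although its orbit has
size `2`.  For line `depth-three-rung` (first rung; ΠΣ and ΣΠΣ(k) sub-rungs): every intermediate value, in
particular every block product of a restoring computation, is untwisted — the sign characters of the census
(twisted support blocks) must be cancelled INSIDE one product step, never carried by a value.

Everything is proved. [folklore]

## References
* A. Dawar, G. Wilsenach, *Symmetric arithmetic circuits*, ToC 21 (2025), Def. 6.1, Thm 6.3 (support theorem).
  [DawarWilsenach2025]
* M. Anderson, A. Dawar, *On symmetric circuits and fixed-point logics*, Theory Comput. Syst. 60 (2017), §3.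
  [AndersonDawar2016]
* J. D. Dixon, B. Mortimer, *Permutation Groups*, GTM 163 (1996), Thm 5.2B. [DixonMortimer1996]
-/

noncomputable section

open scoped Classical

-- `Summit.ValiantsHypothesis.ValiantsHypothesis.…` is the tree's single-conjunct layout (Sub = Summit).
set_option linter.dupNamespace false

namespace Summit.ValiantsHypothesis.ValiantsHypothesis.Theorems

namespace ValueSymSupport

open Equiv Literature.Computability.AlgebraicComplexity OrbitRestorationQPDepthThreeRung

variable {n : ℕ}

/-! ### Generation: the pointwise stabiliser of `X` is generated by the transpositions outside `X` -/

/-- A transposition of two indices outside `X` fixes every index of `X`. [folklore] -/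
theorem swap_apply_of_mem {X : Finset (Fin n)} {a b x : Fin n} (ha : a ∉ X) (hb : b ∉ X) (hx : x ∈ X) :
    swap a b x = x :=
  swap_apply_of_ne_of_ne (by rintro rfl; exact ha hx) (by rintro rfl; exact hb hx)

/-- If every transposition of two indices outside `X` fixes `q`, then every permutation fixing `X` pointwise
fixes `q` (induction on the support of the permutation). [folklore] -/
theorem fixes_of_swap_fixes (X : Finset (Fin n)) {q : MvPolynomial (Fin n × Fin n) ℂ}
    (h : ∀ a b : Fin n, a ∉ X → b ∉ X → a ≠ b → ren (swap a b) q = q) :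
    ∀ ρ : Perm (Fin n), (∀ x ∈ X, ρ x = x) → ren ρ q = q := by
  suffices H : ∀ N : ℕ, ∀ ρ : Perm (Fin n), ρ.support.card ≤ N → (∀ x ∈ X, ρ x = x) → ren ρ q = q from
    fun ρ => H _ ρ le_rfl
  intro N
  induction N with
  | zero =>
    intro ρ hρ _
    have hρ1 : ρ = 1 := Perm.support_eq_empty_iff.1 (Finset.card_eq_zero.1 (Nat.le_zero.1 hρ))
    rw [hρ1, ren_one]
  | succ N ih =>
    intro ρ hρ hX
    by_cases h1 : ρ = 1
    · rw [h1, ren_one]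
    have hna : ¬ ∀ a, ρ a = a := fun hc => h1 (Equiv.ext hc)
    obtain ⟨a, ha⟩ := not_forall.1 hna
    have haX : a ∉ X := fun haX => ha (hX a haX)
    have hρaX : ρ a ∉ X := fun h' => ha (ρ.injective (hX (ρ a) h'))
    have hne : a ≠ ρ a := fun h' => ha h'.symm
    have hcard : (swap a (ρ a) * ρ).support.card < ρ.support.card := Perm.card_support_swap_mul ha
    have hρ'X : ∀ x ∈ X, (swap a (ρ a) * ρ) x = x := by
      intro x hx
      rw [Perm.mul_apply, hX x hx, swap_apply_of_mem haX hρaX hx]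
    have e1 : ren (swap a (ρ a) * ρ) q = q := ih _ (by omega) hρ'X
    have e2 : ρ = swap a (ρ a) * (swap a (ρ a) * ρ) := by rw [← mul_assoc, swap_mul_self, one_mul]
    rw [e2, ren_mul, e1, h a (ρ a) haX hρaX hne]

/-- Two distinct indices outside a set that leaves room for them. [folklore] -/
theorem exists_pair_not_mem (Y : Finset (Fin n)) (hY : Y.card + 2 ≤ n) :
    ∃ a b : Fin n, a ∉ Y ∧ b ∉ Y ∧ a ≠ b := by
  have hbig : 1 < (Finset.univ \ Y).card := by
    rw [Finset.card_sdiff_of_subset (Finset.subset_univ _), Finset.card_univ, Fintype.card_fin]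
    omega
  obtain ⟨a, ha, b, hb, hab⟩ := Finset.one_lt_card.1 hbig
  simp only [Finset.mem_sdiff, Finset.mem_univ, true_and] at ha hb
  exact ⟨a, b, ha, hb, hab⟩

/-! ### Upgrading an alternating support -/

/-- **Upgrade by a far transposition.**  If the even permutations fixing `X` pointwise fix `q`, and ALL
permutations fixing some `Y` pointwise fix `q`, with two indices to spare outside `X ∪ Y`, then all permutations
fixing `X` pointwise fix `q`: a transposition `τ` outside `X` is `(τ τ') τ'` with `τ'` a transposition outside
`X ∪ Y`, `τ τ'` even. [folklore] -/
theorem symFixes_of_altFixes_of_fixes {X Y : Finset (Fin n)} {q : MvPolynomial (Fin n × Fin n) ℂ}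
    (hX : ∀ ρ : Perm (Fin n), (∀ x ∈ X, ρ x = x) → Perm.sign ρ = 1 → ren ρ q = q)
    (hY : ∀ ρ : Perm (Fin n), (∀ y ∈ Y, ρ y = y) → ren ρ q = q) (hroom : (X ∪ Y).card + 2 ≤ n) :
    ∀ ρ : Perm (Fin n), (∀ x ∈ X, ρ x = x) → ren ρ q = q := by
  refine fixes_of_swap_fixes X fun a b ha hb hab => ?_
  obtain ⟨c, d, hc, hd, hcd⟩ := exists_pair_not_mem (X ∪ Y) hroom
  simp only [Finset.mem_union, not_or] at hc hd
  have e1 : ren (swap c d) q = q := hY _ fun y hy => swap_apply_of_mem hc.2 hd.2 hy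
  have e2 : ren (swap a b * swap c d) q = q := by
    refine hX _ (fun x hx => ?_) ?_
    · rw [Perm.mul_apply, swap_apply_of_mem hc.1 hd.1 hx, swap_apply_of_mem ha hb hx]
    · rw [Perm.sign_mul, Perm.sign_swap hab, Perm.sign_swap hcd]; decide
  calc ren (swap a b) q = ren (swap a b * swap c d * swap c d) q := by rw [mul_assoc, swap_mul_self, mul_one]
    _ = q := by rw [ren_mul, e1, e2]

/-! ### Sums of supported values -/

/-- Membership in the finite set of even permutations fixing `X` pointwise. [folklore] -/
theorem mem_evenFix {X : Finset (Fin n)} {g : Perm (Fin n)} :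
    g ∈ (Finset.univ.filter fun g : Perm (Fin n) => (∀ x ∈ X, g x = x) ∧ Perm.sign g = 1) ↔
      (∀ x ∈ X, g x = x) ∧ Perm.sign g = 1 := by
  simp only [Finset.mem_filter, Finset.mem_univ, true_and]

/-- Right multiplication by a product of two transpositions outside `X` permutes the even permutations fixing
`X` pointwise, hence re-indexes sums over them. [folklore] -/
theorem sum_evenFix_mul_swap_swap {X : Finset (Fin n)} {a b c d : Fin n} (ha : a ∉ X) (hb : b ∉ X)
    (hc : c ∉ X) (hd : d ∉ X) (hab : a ≠ b) (hcd : c ≠ d) (F : Perm (Fin n) → MvPolynomial (Fin n × Fin n) ℂ) :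
    ∑ g ∈ (Finset.univ.filter fun g : Perm (Fin n) => (∀ x ∈ X, g x = x) ∧ Perm.sign g = 1),
        F (g * swap a b * swap c d) =
      ∑ g ∈ (Finset.univ.filter fun g : Perm (Fin n) => (∀ x ∈ X, g x = x) ∧ Perm.sign g = 1), F g := by
  set E := (Finset.univ.filter fun g : Perm (Fin n) => (∀ x ∈ X, g x = x) ∧ Perm.sign g = 1) with hE
  have hsw : ∀ x ∈ X, (swap a b * swap c d) x = x := fun x hx => by
    rw [Perm.mul_apply, swap_apply_of_mem hc hd hx, swap_apply_of_mem ha hb hx]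
  have hsgn : Perm.sign (swap a b * swap c d) = 1 := by
    rw [Perm.sign_mul, Perm.sign_swap hab, Perm.sign_swap hcd]; decide
  have hmem : ∀ g : Perm (Fin n), g ∈ E ↔ g * swap a b * swap c d ∈ E := by
    intro g
    rw [hE, mem_evenFix, mem_evenFix, mul_assoc]
    constructor
    · rintro ⟨h1, h2⟩
      exact ⟨fun x hx => by rw [Perm.mul_apply, hsw x hx, h1 x hx], by rw [Perm.sign_mul, h2, hsgn, mul_one]⟩
    · rintro ⟨h1, h2⟩
      refine ⟨fun x hx => ?_, ?_⟩
      · have := h1 x hx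
        rwa [Perm.mul_apply, hsw x hx] at this
      · rwa [Perm.sign_mul, hsgn, mul_one] at h2
  have hinv : ∀ h : Perm (Fin n), h * swap c d * swap a b * swap a b * swap c d = h := fun h => by
    rw [mul_assoc (h * swap c d), swap_mul_self, mul_one, mul_assoc, swap_mul_self, mul_one]
  refine Finset.sum_bij (fun g _ => g * swap a b * swap c d) (fun g hg => (hmem g).1 hg) ?_ ?_ (fun _ _ => rfl)
  · intro g₁ _ g₂ _ h
    exact mul_right_cancel (mul_right_cancel h)
  · intro h hh
    exact ⟨h * swap c d * swap a b, (hmem _).2 (by rw [hinv]; exact hh), hinv h⟩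

/-- Expanding a weighted sum inside a sum of renamings. [folklore] -/
theorem sum_ren_multiset_sum (E : Finset (Perm (Fin n))) (φ : Perm (Fin n) → Perm (Fin n))
    (D : Multiset (ℂ × MvPolynomial (Fin n × Fin n) ℂ)) :
    ∑ g ∈ E, ren (φ g) (D.map fun cu => MvPolynomial.C cu.1 * cu.2).sum =
      (D.map fun cu => MvPolynomial.C cu.1 * ∑ g ∈ E, ren (φ g) cu.2).sum := by
  simp only [map_multiset_sum, Multiset.map_map, Function.comp_def, map_mul, ren_C, Finset.mul_sum]
  rw [Finset.sum_eq_multiset_sum, Multiset.sum_map_sum_map]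
  refine congrArg _ (Multiset.map_congr rfl fun cu _ => ?_)
  rw [Finset.sum_eq_multiset_sum]

/-- Cancelling a nonzero natural multiple in the polynomial ring. [folklore] -/
theorem eq_of_nsmul_eq {N : ℕ} (hN : N ≠ 0) {p q : MvPolynomial (Fin n × Fin n) ℂ} (h : N • p = N • q) :
    p = q := by
  rw [nsmul_eq_mul, nsmul_eq_mul, ← map_natCast (MvPolynomial.C (σ := Fin n × Fin n) (R := ℂ)) N] at h
  have hC : MvPolynomial.C (σ := Fin n × Fin n) ((N : ℂ)) ≠ 0 := by
    rw [Ne, MvPolynomial.C_eq_zero]; exact Nat.cast_ne_zero.2 hN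
  exact mul_left_cancel₀ hC h

/-- **Sums of supported values are supported by the alternating support.**  If the even permutations fixing
`X` pointwise fix `q = Σ_{(c,u) ∈ D} c·u`, and every summand `u` is fixed by all permutations fixing some `Y_u`
pointwise with two indices to spare outside `X ∪ Y_u`, then all permutations fixing `X` pointwise fix `q`.
Mechanism: for a transposition `τ` outside `X`, `Σ_{g even, fixing X} ren g q = N • q` and
`Σ_g ren (g τ) q = N • ren τ q`; expanding `q`, the two sums agree summand by summand after re-indexing
`g ↦ g τ τ_u` with a transposition `τ_u` fixing `u`. [folklore] -/
theorem symFixes_sum {X : Finset (Fin n)} {q : MvPolynomial (Fin n × Fin n) ℂ}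
    (hX : ∀ ρ : Perm (Fin n), (∀ x ∈ X, ρ x = x) → Perm.sign ρ = 1 → ren ρ q = q)
    (D : Multiset (ℂ × MvPolynomial (Fin n × Fin n) ℂ))
    (hq : (D.map fun cu => MvPolynomial.C cu.1 * cu.2).sum = q)
    (hD : ∀ cu ∈ D, ∃ Y : Finset (Fin n), (X ∪ Y).card + 2 ≤ n ∧
      ∀ ρ : Perm (Fin n), (∀ y ∈ Y, ρ y = y) → ren ρ cu.2 = cu.2) :
    ∀ ρ : Perm (Fin n), (∀ x ∈ X, ρ x = x) → ren ρ q = q := by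
  refine fixes_of_swap_fixes X fun a b ha hb hab => ?_
  set E := (Finset.univ.filter fun g : Perm (Fin n) => (∀ x ∈ X, g x = x) ∧ Perm.sign g = 1) with hE
  have hτX : ∀ x ∈ X, swap a b x = x := fun x hx => swap_apply_of_mem ha hb hx
  -- (A) the sum of `ren g q` over `E` is `|E| • q`
  have hA : ∑ g ∈ E, ren g q = E.card • q := by
    rw [Finset.sum_congr rfl fun g hg => hX g ((mem_evenFix.1 hg).1) ((mem_evenFix.1 hg).2), Finset.sum_const]
  -- (B) the sum of `ren (g τ) q` over `E` is `|E| • ren τ q`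
  have hB : ∑ g ∈ E, ren (g * swap a b) q = E.card • ren (swap a b) q := by
    rw [Finset.sum_congr rfl fun g hg => ?_, Finset.sum_const]
    obtain ⟨h1, h2⟩ := mem_evenFix.1 hg
    have hconj : ren (swap a b * g * swap a b) q = q := by
      refine hX _ (fun x hx => ?_) ?_
      · rw [Perm.mul_apply, Perm.mul_apply, hτX x hx, h1 x hx, hτX x hx]
      · rw [Perm.sign_mul, Perm.sign_mul, h2, mul_one, ← Perm.sign_mul, swap_mul_self, Perm.sign_one]
    calc ren (g * swap a b) q = ren (swap a b * (swap a b * g * swap a b)) q := by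
          rw [← mul_assoc, ← mul_assoc, swap_mul_self, one_mul]
      _ = ren (swap a b) q := by rw [ren_mul, hconj]
  -- (C) for each summand the two sums agree
  have hC : ∀ cu ∈ D, ∑ g ∈ E, ren (g * swap a b) cu.2 = ∑ g ∈ E, ren g cu.2 := by
    intro cu hcu
    obtain ⟨Y, hroom, hY⟩ := hD cu hcu
    obtain ⟨c, d, hc, hd, hcd⟩ := exists_pair_not_mem (X ∪ Y) hroom
    simp only [Finset.mem_union, not_or] at hc hd
    have hu : ren (swap c d) cu.2 = cu.2 := hY _ fun y hy => swap_apply_of_mem hc.2 hd.2 hy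
    calc ∑ g ∈ E, ren (g * swap a b) cu.2
        = ∑ g ∈ E, ren (g * swap a b * swap c d * swap c d) cu.2 := by
          refine Finset.sum_congr rfl fun g _ => ?_
          rw [mul_assoc (g * swap a b), swap_mul_self, mul_one]
      _ = ∑ g ∈ E, ren (g * swap c d) cu.2 :=
          sum_evenFix_mul_swap_swap ha hb hc.1 hd.1 hab hcd (fun g => ren (g * swap c d) cu.2)
      _ = ∑ g ∈ E, ren g cu.2 := Finset.sum_congr rfl fun g _ => by rw [ren_mul, hu]
  -- (D) expand `q` in both sums and compare
  have hD1 : ∑ g ∈ E, ren g q = (D.map fun cu => MvPolynomial.C cu.1 * ∑ g ∈ E, ren g cu.2).sum := by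
    rw [← hq]; exact sum_ren_multiset_sum E id D
  have hD2 : ∑ g ∈ E, ren (g * swap a b) q =
      (D.map fun cu => MvPolynomial.C cu.1 * ∑ g ∈ E, ren g cu.2).sum := by
    rw [← hq, sum_ren_multiset_sum E (· * swap a b) D]
    exact congrArg _ (Multiset.map_congr rfl fun cu hcu => by rw [hC cu hcu])
  have hE1 : (1 : Perm (Fin n)) ∈ E := mem_evenFix.2 ⟨fun _ _ => rfl, Perm.sign_one⟩
  have hcard : E.card ≠ 0 := Finset.card_ne_zero.2 ⟨1, hE1⟩
  have := hA.symm.trans (hD1.trans (hD2.symm.trans hB))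
  exact (eq_of_nsmul_eq hcard this).symm

/-! ### The support theorem for values -/

/-- **THE SUPPORT THEOREM FOR VALUES.**  Let `n > 8`, `3 ≤ k`, `4k ≤ n`.  If every value of a value derivation
on the `n × n` matrix has fewer than `C(n,k)` translates under the diagonal action of `Sym(Fin n)`, then EVERY
value is fixed by every permutation fixing pointwise some set of fewer than `k` indices (a support in the sense
of Dawar–Wilsenach Def. 6.1).  Induction on the rank; variables / constants / products by
`symFixes_of_altFixes_of_fixes`, sums by `symFixes_sum`, the alternating support from
`ValueSupport.exists_altSupport_of_ncard_lt_choose`. [folklore; cite: DawarWilsenach2025, Def. 6.1, Thm 6.3] -/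
theorem exists_symSupport {k : ℕ} (hn : 8 < n) (hk : 3 ≤ k) (h4k : 4 * k ≤ n)
    (𝒟 : ValueDerivation ℂ (Fin n × Fin n))
    (hS : ∀ q ∈ 𝒟.S, (Set.range fun σ : Perm (Fin n) => ren σ q).ncard < n.choose k) :
    ∀ q ∈ 𝒟.S, ∃ X : Finset (Fin n), X.card < k ∧ ∀ ρ : Perm (Fin n), (∀ x ∈ X, ρ x = x) → ren ρ q = q := by
  suffices H : ∀ r : ℕ, ∀ q ∈ 𝒟.S, 𝒟.rank q < r →
      ∃ X : Finset (Fin n), X.card < k ∧ ∀ ρ : Perm (Fin n), (∀ x ∈ X, ρ x = x) → ren ρ q = q from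
    fun q hq => H _ q hq (Nat.lt_succ_self _)
  intro r
  induction r with
  | zero => intro q _ h; exact absurd h (Nat.not_lt_zero _)
  | succ r ih =>
    intro q hq hqr
    obtain ⟨X, hXk, hX⟩ := ValueSupport.exists_altSupport_of_ncard_lt_choose hn (by omega) h4k q (hS q hq)
    obtain ⟨d, hd⟩ := 𝒟.step q hq
    have IH : ∀ u ∈ d.args, ∃ Y : Finset (Fin n), Y.card < k ∧
        ∀ ρ : Perm (Fin n), (∀ y ∈ Y, ρ y = y) → ren ρ u = u := fun u hu =>
      ih u (hd.args_lt u hu).1 (lt_of_lt_of_le (hd.args_lt u hu).2 (Nat.lt_succ_iff.1 hqr))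
    refine ⟨X, hXk, ?_⟩
    cases d with
    | var x =>
      have hv : q = MvPolynomial.X x := hd.value_eq.symm
      refine symFixes_of_altFixes_of_fixes hX (Y := {x.1, x.2}) (fun ρ hρ => ?_) ?_
      · rw [hv, ren_X]
        congr 1
        refine Prod.ext ?_ ?_
        · exact hρ _ (by simp)
        · exact hρ _ (by simp)
      · have h1 := (Finset.card_union_le X {x.1, x.2}).trans (Nat.add_le_add_left (Finset.card_insert_le _ _) _)
        rw [Finset.card_singleton] at h1
        omega
    | const c =>
      have hv : q = MvPolynomial.C c := hd.value_eq.symm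
      refine symFixes_of_altFixes_of_fixes hX (Y := ∅) (fun ρ _ => by rw [hv, ren_C]) ?_
      rw [Finset.union_empty]; omega
    | sum D =>
      refine symFixes_sum hX D hd.value_eq fun cu hcu => ?_
      obtain ⟨Y, hYk, hY⟩ := IH cu.2 (Multiset.mem_map_of_mem Prod.snd hcu)
      refine ⟨Y, ?_, hY⟩
      have := Finset.card_union_le X Y
      omega
    | prod u v =>
      have hv : q = u * v := hd.value_eq.symm
      obtain ⟨Yu, hYuk, hYu⟩ := IH u (by simp [StepData.args])
      obtain ⟨Yv, hYvk, hYv⟩ := IH v (by simp [StepData.args])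
      refine symFixes_of_altFixes_of_fixes hX (Y := Yu ∪ Yv) (fun ρ hρ => ?_) ?_
      · rw [hv, map_mul, hYu ρ fun y hy => hρ y (Finset.mem_union_left _ hy),
          hYv ρ fun y hy => hρ y (Finset.mem_union_right _ hy)]
      · have := (Finset.card_union_le X (Yu ∪ Yv)).trans (Nat.add_le_add_left (Finset.card_union_le Yu Yv) _)
        omega

/-- **The support theorem for wide derivations.**  In a wide derivation (sums and products of any fan-in) of
orbit WIDTH `< C(n,k)` every value is fixed by the pointwise stabiliser of fewer than `k` indices. [folklore] -/
theorem exists_symSupport_of_wide {k B : ℕ} (hn : 8 < n) (hk : 3 ≤ k) (h4k : 4 * k ≤ n)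
    (𝒲 : WideDerivation ℂ (Fin n × Fin n)) (hW : 𝒲.OrbitWidthLE (Perm (Fin n)) B) (hB : B < n.choose k) :
    ∀ q ∈ 𝒲.S, ∃ X : Finset (Fin n), X.card < k ∧ ∀ ρ : Perm (Fin n), (∀ x ∈ X, ρ x = x) → ren ρ q = q := by
  obtain ⟨𝒟, hsub, hS⟩ := WideDerivation.exists_valueDerivation_of_wide 𝒲 hW
  intro q hq
  exact exists_symSupport hn hk h4k 𝒟 (fun q hq => (hS q hq).trans_lt hB) q (hsub q hq)

/-- **The support theorem behind `QPOrbitRestorable`.**  A quasi-polynomially orbit-restorable polynomial (line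
vocabulary) is the last value of a computation ALL of whose values are fixed by the pointwise stabiliser of fewer
than `k` indices, as soon as `2^((log₂ n + c)^c) < C(n,k)` (`n > 8`, `3 ≤ k ≤ n/4`). [folklore] -/
theorem exists_symSupport_of_qpOrbitRestorable {c k : ℕ} (hn : 8 < n) (hk : 3 ≤ k) (h4k : 4 * k ≤ n)
    (hck : 2 ^ ((Nat.log 2 n + c) ^ c) < n.choose k) {p : MvPolynomial (Fin n × Fin n) ℂ}
    (hp : QPOrbitRestorable c n p) :
    ∃ 𝒟 : ValueDerivation ℂ (Fin n × Fin n), p ∈ 𝒟.S ∧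
      ∀ q ∈ 𝒟.S, ∃ X : Finset (Fin n), X.card < k ∧ ∀ ρ : Perm (Fin n), (∀ x ∈ X, ρ x = x) → ren ρ q = q := by
  obtain ⟨-, 𝒟, hp𝒟, hS⟩ := ValueOrbit.exists_valueDerivation_of_qpOrbitRestorable hp
  exact ⟨𝒟, hp𝒟, exists_symSupport hn hk h4k 𝒟 fun q hq => (hS q hq).trans_lt hck⟩

/-! ### Twisted values never occur: the diagonal Vandermonde -/

/-- Renaming the diagonal Vandermonde determinant `det (x_ii ^ j)` by `ρ` multiplies it by `sign ρ`.
[folklore] -/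
theorem ren_diagVandermonde (ρ : Perm (Fin n)) :
    ren ρ (Matrix.vandermonde fun i : Fin n => (MvPolynomial.X (i, i) : MvPolynomial (Fin n × Fin n) ℂ)).det =
      ((Perm.sign ρ : ℤ) : ℂ) • (Matrix.vandermonde fun i : Fin n =>
        (MvPolynomial.X (i, i) : MvPolynomial (Fin n × Fin n) ℂ)).det := by
  set v : Fin n → MvPolynomial (Fin n × Fin n) ℂ := fun i => MvPolynomial.X (i, i) with hv
  have h1 : ren ρ (Matrix.vandermonde v).det = (Matrix.vandermonde (v ∘ ρ)).det := by
    rw [AlgHom.map_det]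
    congr 1
    ext i j
    simp [Matrix.vandermonde_apply, hv, map_pow, AlgHom.mapMatrix_apply]
  have h2 : Matrix.vandermonde (v ∘ ρ) = (Matrix.vandermonde v).submatrix ρ id := by
    ext i j; simp [Matrix.vandermonde_apply]
  rw [h1, h2, Matrix.det_permute, MvPolynomial.smul_eq_C_mul, map_intCast]

/-- The diagonal Vandermonde has at most two translates (`± itself`). [folklore] -/
theorem ncard_orbit_diagVandermonde_le_two :
    (Set.range fun σ : Perm (Fin n) => ren σ
      (Matrix.vandermonde fun i : Fin n => (MvPolynomial.X (i, i) : MvPolynomial (Fin n × Fin n) ℂ)).det).ncard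
        ≤ 2 := by
  set Dv := (Matrix.vandermonde fun i : Fin n =>
    (MvPolynomial.X (i, i) : MvPolynomial (Fin n × Fin n) ℂ)).det with hDv
  have hsub : (Set.range fun σ : Perm (Fin n) => ren σ Dv) ⊆ ({Dv, -Dv} : Finset _) := by
    rintro _ ⟨σ, rfl⟩
    simp only [Finset.coe_insert, Finset.coe_singleton, Set.mem_insert_iff, Set.mem_singleton_iff]
    rw [hDv, ren_diagVandermonde]
    rcases Int.units_eq_one_or (Perm.sign σ) with hs | hs
    · left; rw [hs]; simp
    · right; rw [hs]; simp
  calc (Set.range fun σ : Perm (Fin n) => ren σ Dv).ncard ≤ (({Dv, -Dv} : Finset _) : Set _).ncard :=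
        Set.ncard_le_ncard hsub (Finset.finite_toSet _)
    _ = ({Dv, -Dv} : Finset _).card := Set.ncard_coe_finset _
    _ ≤ 2 := Finset.card_le_two

/-- **The diagonal Vandermonde is never a value of a small-orbit computation** (`n > 8`, `3 ≤ k ≤ n/4`, all
values with fewer than `C(n,k)` translates), although its own orbit has size `2`: a support of fewer than
`k ≤ n − 2` indices leaves a transposition outside it, which negates the Vandermonde. [folklore] -/
theorem diagVandermonde_not_mem {k : ℕ} (hn : 8 < n) (hk : 3 ≤ k) (h4k : 4 * k ≤ n)
    (𝒟 : ValueDerivation ℂ (Fin n × Fin n))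
    (hS : ∀ q ∈ 𝒟.S, (Set.range fun σ : Perm (Fin n) => ren σ q).ncard < n.choose k) :
    (Matrix.vandermonde fun i : Fin n => (MvPolynomial.X (i, i) : MvPolynomial (Fin n × Fin n) ℂ)).det ∉ 𝒟.S := by
  set Dv := (Matrix.vandermonde fun i : Fin n =>
    (MvPolynomial.X (i, i) : MvPolynomial (Fin n × Fin n) ℂ)).det with hDv
  intro hmem
  obtain ⟨X, hXk, hX⟩ := exists_symSupport hn hk h4k 𝒟 hS Dv hmem
  obtain ⟨a, b, ha, hb, hab⟩ := exists_pair_not_mem X (by omega)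
  have h1 : ren (swap a b) Dv = Dv := hX _ fun x hx => swap_apply_of_mem ha hb hx
  have h2 : ren (swap a b) Dv = -Dv := by
    rw [hDv, ren_diagVandermonde, Perm.sign_swap hab]; simp
  have hne : Dv ≠ 0 := by
    intro h0
    obtain ⟨i, j, hij, hne⟩ := Matrix.det_vandermonde_eq_zero_iff.1 h0
    exact hne (congrArg Prod.fst (MvPolynomial.X_injective hij))
  have h3 : (2 : ℂ) • Dv = 0 := by
    rw [two_smul]
    nth_rewrite 1 [← h1]
    rw [h2, neg_add_cancel]
  rw [smul_eq_zero] at h3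
  rcases h3 with h3 | h3
  · norm_num at h3
  · exact hne h3

end ValueSymSupport

end Summit.ValiantsHypothesis.ValiantsHypothesis.Theorems

end
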